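import Summits.ABC.ABC.Theses.FeketeScales

/-!
# NAP is vacuous in a world without near-good scales (kernel position of the R4 re-cut)

Crux `stmt-ABC-2160`, decl `Summit.ABC.ABC.Theses.FeketeScales.ScaleSubmultiplicativity`, route
`FeketeScales` (ABC/ABC); lead c6 helper (`--supports`), part 3 of the answer to the crux-strategist's
finding R4 (`Cruxes/ScaleSubmultiplicativity/STRATEGY-CENSUS.md`, seat s1; companion
`StrategistS1.nearGoodPropagation_of_eventually_bad`, restated over tree vocabulary with `Good` inlined).

`NAP(δ₀)` (near-good propagation in the window `[1, 1+δ₀]`, see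
`FeketeScalesScaleSubmultiplicativityNapIteration.lean`) has hypotheses "both factor scales are `l`-good
for some `l ≤ 1 + δ₀`".  If from some scale on NO scale is `(1+δ₀)`-good — e.g. if abc failed with a
definite power law `G(R) > R^{1+δ₀}` at every large `R` — these hypotheses are never met and `NAP(δ₀)`
holds trivially (`nap_of_eventually_bad`).  Contrast: the crux implies polynomial abc unconditionally
(`polynomialAbcOfSubmult_proof`, stmt-ABC-2163), so it fails under any super-polynomial growth of the
records; `NAP` does not — it has no hypothesis-free pointwise consequence visible to the kernel.  With
part 1 (`nap_of_scaleSubmultiplicativity` : crux → NAP) and part 2 (`abc_of_nap_of_sparseGoodScales` :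
NAP → SparseGoodScales → ABC) this is the complete kernel record behind R4: NAP is strictly cheaper in
proof-content than the crux yet decides the summit with `SparseGoodScales` through a Fekete assembly.

References: STRATEGY-CENSUS §R4 (seat s1); Mathlib only.  (No conditional refutation of the crux is
stated here on purpose: `¬crux` modulo super-polynomial records is just the contrapositive of
stmt-ABC-2163 and would belong under `Theorems/ScaleSubmultiplicativity/Negative/`.)
-/

-- `Summit.<Summit>.<Problem>` is the mandated summit-side namespace (CONVENTIONS §2); for the
-- single-conjunct summit `ABC` the two coincide, so the duplicate `ABC.ABC` is deliberate.
set_option linter.dupNamespace false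

namespace Summit.ABC.ABC.Theorems

open Literature.NumberTheory.DiophantineGeometry

/-- **Vacuity of NAP(δ₀) without near-good scales.**  If beyond some scale `N` no scale `R` is
`(1+δ₀)`-good (for every `R ≥ N` some abc triple of radical `≤ R` has `c > R^{1+δ₀}`), then near-good
propagation in the window `[1, 1+δ₀]` holds trivially (`θ = 0`, `K = 1`, thresholds `max N 1`): an
`l`-good scale `R₁ ≥ N` with `l ≤ 1 + δ₀` would be `(1+δ₀)`-good.  (Crux-strategist s1,
`StrategistS1.nearGoodPropagation_of_eventually_bad`.) [folklore] -/
theorem ScaleSubmultiplicativity.nap_of_eventually_bad :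
    ∀ δ₀ : ℝ, (∃ N : ℕ, ∀ R : ℕ, N ≤ R →
      ¬ (∀ a b c : ℕ, IsABCTriple a b c → rad a b c ≤ R → (c : ℝ) ≤ (R : ℝ) ^ (1 + δ₀))) →
    ∃ θ : ℝ, θ < 1 ∧ ∃ K : ℝ, 0 < K ∧ ∃ R₀ : ℕ, ∀ R₁ R₂ : ℕ, R₀ ≤ R₁ → R₀ ≤ R₂ →
      ∀ l : ℝ, 1 ≤ l → l ≤ 1 + δ₀ →
      (∀ a b c : ℕ, IsABCTriple a b c → rad a b c ≤ R₁ → (c : ℝ) ≤ (R₁ : ℝ) ^ l) →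
      (∀ a b c : ℕ, IsABCTriple a b c → rad a b c ≤ R₂ → (c : ℝ) ≤ (R₂ : ℝ) ^ l) →
      ∀ a b c : ℕ, IsABCTriple a b c → rad a b c ≤ R₁ * R₂ →
        (c : ℝ) ≤ K * Real.exp (Real.log ((R₁ : ℝ) * R₂) ^ θ) * ((R₁ : ℝ) * R₂) ^ l := by
  rintro δ₀ ⟨N, hN⟩
  refine ⟨0, zero_lt_one, 1, one_pos, max N 1, ?_⟩
  intro R₁ R₂ hR₁ _ l _ hl1 g₁ _ a b c _ _
  exfalso
  have hR₁1 : (1 : ℝ) ≤ (R₁ : ℝ) := by exact_mod_cast (le_max_right _ _).trans hR₁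
  have hmono : (R₁ : ℝ) ^ l ≤ (R₁ : ℝ) ^ (1 + δ₀) := Real.rpow_le_rpow_of_exponent_le hR₁1 hl1
  exact hN R₁ ((le_max_left _ _).trans hR₁) (fun a b c ht hr => (g₁ a b c ht hr).trans hmono)

end Summit.ABC.ABC.Theorems
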